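import Literature.AlgebraicGeometry.Motives.HodgeLieUnitaryTimesCMSummandSU
import Literature.AlgebraicGeometry.Motives.HodgeLieUnitarySUDerived
import Literature.AlgebraicGeometry.HodgeTheory.CMAbelianVarietySkewCommutantHodgeLie
import Literature.AlgebraicGeometry.HodgeTheory.UnitaryHodgeGroupAdmissibleOfRibetType
import Literature.AlgebraicGeometry.HodgeTheory.WeilTypeHodgeGroupSemisimpleOfCentre
import Literature.AlgebraicGeometry.Motives.HodgeLieOfAbelianVarietySemisimpleTimesCM
import HarnessLib

/-!
# `Lie Hg(H¹(Y₃ × Z₃)) ⊗ ℂ ⊇ 𝔰(𝔲(W_Y) ⊕ 𝔲_F(W_Z))_ℂ` — the AV READING of the product brick `WeilProductCM` (v1.2) for TABLE X ROW 22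
# (`Y₃ × Z₃`: `Y` a threefold with `End⁰ = k` imaginary quadratic of signature `(2,1)`, `Z` a SIMPLE CM threefold whose CM field
# contains the SAME `k`, the diagonal `k` of Weil type `(3,3)`) (Moonen–Zarhin 1999 §5; Ribet 1983 Thm. 3; Deligne I §3)

Family `hodge`, layer `Literature/AlgebraicGeometry/HodgeTheory` (cell `pub-hodgeav-hg6`, req-37 (A) Q2b, TABLE X ROW 22; eng-3 g4, brick
R22-b; lead g4 2026-08-29).  UNCONDITIONAL; theorems only, no definition, no named fact, no `sorry`.  HONEST FRAMING of that cell: HC ∕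
HC_AV (stmt-1333) ∕ HC_CM (stmt-3052) ∕ H2 NOT proved — a statement about `Lie Hg(Y × Z)`.

WHAT THIS FILE DOES (the text of eng-4's R17-AV `WeilTypeFivefoldTimesCMCurveHodgeLieSU` mutatis mutandis).  The brick
`WeilProductCM.mem_hodgeLieC_of_commute_of_skew_of_trace_of_abelian` (`Motives/HodgeLieUnitaryTimesCMSummandSU`, K1 v1.2: `H ≅ H₁ ⊕ H₂`,
`H₂` with ABELIAN Hodge Lie algebra, balance of the glued `k`-action, inputs `hLie₁`, `hSL₁`, `hab₂`, `hY₂`) is READ on `Y × Z` through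
the bicone `H¹(Y × Z) = fst^* H¹(Y) ⊕ snd^* H¹(Z)`, with ALL FOUR inputs DISCHARGED:
* `hLie₁` for `Y = Y₃` (`dim Y = 3`, `finrank_ℚ End⁰(Y) = 2`, `φ_Y ≫ φ_Y = −d`, multiplicity `1` at `i√d` or `−i√d`) by the `(m,1)` core
  `UnitaryTheta.mem_spanC_of_commute_of_skew` through F17's dictionary (= F-ADM `mem_spanC_typeOne_of_eigenMultiplicity_eq_one`);
* `hSL₁` by eng-5's K1b `UnitarySU.mem_span_commutator_of_trace` (`End_Hdg(H¹Y) = ℚ + ℚφ_Y^*` from `finrank End⁰ Y = 2`);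
* `hab₂`, `hY₂` for the SIMPLE CM threefold `Z` (a realisation `IsCMTypeRealisation Φ Z ι θ`, `dim Z = 3` prime) by R22-a
  (`CMTorusTheta.hodgeLie_comm_of_isCMTypeRealisation`, `CMTorusTheta.mem_hodgeLieC_of_forall_commute_pull_of_skew`);
* the balance from the row's datum `IsWeilType (Y × Z) Φ 3 d` for the diagonal `Φ` (`Φ ≫ fst = fst ≫ φ_Y`, `Φ ≫ snd = snd ≫ φ_Z`).

* **`hodgeLieC_threefold_prod_cmThreefold_of_typeOne`** — for EVERY polarization `ψ` of `H¹(Y × Z; ℚ)`: every operator on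
  `H¹(Y × Z; ℂ)` commuting with the projector `(fst ≫ prodLift (𝟙 Y) 0)^*_ℂ`, with `Φ^*_ℂ` and with `(snd ≫ g ≫ prodLift 0 (𝟙 Z))^*_ℂ`
  for every `g ∈ End(Z)`, skew for `ψ_ℂ` and traceless on `W_k = ker(Φ^*_ℂ − i√d)`, lies in `Lie Hg(H¹(Y × Z)) ⊗ ℂ` («special
  members = ∅» for row 22 at the Lie level, modulo NOTHING).
Not here: the Lie→group passage (eng-2's blocked socket S3) and the census re-key (R22-c).

## References
* [MoonenZarhin1999LowDim] B. Moonen, Yu. Zarhin, Math. Ann. 315 (1999), §2 (2.3), Thm. (2.7), §3 (3.1), §5.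
* [Ribet1983] K. A. Ribet, Amer. J. Math. 105 (1983), Thm. 3.
* [Deligne1982HodgeCycles] P. Deligne, LNM 900 (1982), I §3 Prop. 3.4 and 3.6.
* [VoisinHodgeI2002] C. Voisin, Hodge Theory I (2002), §7.3.2 and Lemma 7.26.
-/

noncomputable section

open scoped TensorProduct
open CategoryTheory CategoryTheory.Limits Module NumberField

namespace Literature.AlgebraicGeometry.HodgeTheory

open Literature.AlgebraicTopology.SingularHomology
open Literature.AlgebraicGeometry.Motives
open Literature.AlgebraicGeometry.Motives.AbelianVariety
open Literature.AlgebraicGeometry.Motives.HodgeStructure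
open Literature.AlgebraicGeometry.ComplexMultiplication (bettiRep bettiRep_of bettiCohomology_map_comp_hom IsCMTypeRealisation)

variable {Y Z : AbelianVariety ℂ}

/-- `(f ≫ g)^* = f^* ∘ g^*` on `H¹(−; ℚ)`, for the linear maps. [folklore] -/
private theorem pull_comp_eq' {A B C : AbelianVariety ℂ} (f : A ⟶ B) (g : B ⟶ C) :
    BettiUniverse.pull (f ≫ g).hom.hom.hom 1 = BettiUniverse.pull f.hom.hom.hom 1 ∘ₗ BettiUniverse.pull g.hom.hom.hom 1 := by
  change (bettiCohomology.map (f ≫ g).hom.hom.hom 1).hom = _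
  rw [bettiCohomology_map_comp_hom, ModuleCat.hom_comp]

/-- **ROW 22 AT THE LIE LEVEL — `Lie Hg(H¹(Y₃ × Z₃)) ⊗ ℂ ⊇ 𝔰(𝔲(W_Y) ⊕ 𝔲_F(W_Z))_ℂ`** (see the module docstring): `Y` with `dim Y = 3`,
`finrank_ℚ End⁰(Y) = 2`, `φ_Y ≫ φ_Y = −d`, multiplicity `1` at `i√d` or at `−i√d`; `Z` a realisation of a CM type `(K; Φ)`, SIMPLE,
`dim Z = 3`, with `φ_Z ≫ φ_Z = −d` (same `d`); `Φ` the diagonal endomorphism of `Y × Z` (`Φ ≫ fst = fst ≫ φ_Y`, `Φ ≫ snd = snd ≫ φ_Z`) of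
Weil type `(3, d)`.  Then for every polarization `ψ` of `H¹(Y × Z; ℚ)`: every operator commuting with the projector
`(fst ≫ prodLift (𝟙 Y) 0)^*_ℂ`, with `Φ^*_ℂ` and with `(snd ≫ g ≫ prodLift 0 (𝟙 Z))^*_ℂ` for all `g ∈ End(Z)`, `ψ_ℂ`-skew and traceless on
`W_k = ker(Φ^*_ℂ − i√d)`, lies in `Lie Hg(H¹(Y × Z)) ⊗ ℂ` — all four inputs of K1 v1.2 discharged.
[cite: MoonenZarhin1999LowDim, §2 (2.3), Thm. (2.7) and §5] [cite: Ribet1983, Thm. 3] [cite: Deligne1982HodgeCycles, I §3 Prop. 3.4 and 3.6] -/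
theorem hodgeLieC_threefold_prod_cmThreefold_of_typeOne [HodgeTensorFacts.{0, 0}]
    (hY3 : Y.dim = 3) (φY : Y ⟶ Y) {d : ℕ} (hd : 0 < d) (hφY : φY ≫ φY = -(d • 𝟙 Y))
    (hE2 : Module.finrank ℚ Y.endAlgebra = 2)
    (h1 : eigenMultiplicity Y φY (Complex.I * (Real.sqrt d : ℂ)) = 1 ∨
      eigenMultiplicity Y φY (-(Complex.I * (Real.sqrt d : ℂ))) = 1)
    {K : Type} [Field K] [NumberField K] [IsCMField K] {Φcm : CMType K} {ιZ : 𝓞 K →+* End Z}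
    {θ : K →+* Module.End ℂ (complexBetti Z.X 1)} (h : IsCMTypeRealisation Φcm Z ιZ θ) (hZs : Z.IsSimple) (hZ3 : Z.dim = 3)
    (φZ : Z ⟶ Z) (hφZ : φZ ≫ φZ = -(d • 𝟙 Z))
    (Φ : Y.prod Z ⟶ Y.prod Z) (hΦ₁ : Φ ≫ fst Y Z = fst Y Z ≫ φY) (hΦ₂ : Φ ≫ snd Y Z = snd Y Z ≫ φZ)
    (hW : IsWeilType (Y.prod Z) Φ 3 d)
    (ψ : (BettiUniverse.hodge exists_isReal_hodgeModel_holds (AbelianVariety.isSmoothProjective_holds (A := Y.prod Z)) 1).Polarization) :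
    ∀ (Yop : Module.End ℂ (ℂ ⊗[ℚ] bettiCohomology (Y.prod Z).X 1)),
      Yop * ((bettiCohomology.map (fst Y Z ≫ prodLift (𝟙 Y) (0 : Y ⟶ Z)).hom.hom.hom 1).hom).baseChange ℂ =
        ((bettiCohomology.map (fst Y Z ≫ prodLift (𝟙 Y) (0 : Y ⟶ Z)).hom.hom.hom 1).hom).baseChange ℂ * Yop →
      ∀ (hYΦ : Yop * ((bettiCohomology.map Φ.hom.hom.hom 1).hom).baseChange ℂ =
        ((bettiCohomology.map Φ.hom.hom.hom 1).hom).baseChange ℂ * Yop),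
      (∀ g : Z ⟶ Z, Yop * ((bettiCohomology.map (snd Y Z ≫ g ≫ prodLift (0 : Z ⟶ Y) (𝟙 Z)).hom.hom.hom 1).hom).baseChange ℂ =
        ((bettiCohomology.map (snd Y Z ≫ g ≫ prodLift (0 : Z ⟶ Y) (𝟙 Z)).hom.hom.hom 1).hom).baseChange ℂ * Yop) →
      (∀ x y, ψ.form.baseChange ℂ (Yop x) y + ψ.form.baseChange ℂ x (Yop y) = 0) →
      LinearMap.trace ℂ _ (Yop.restrict fun x (hx : x ∈ Module.End.eigenspace
          (((bettiCohomology.map Φ.hom.hom.hom 1).hom).baseChange ℂ) (Complex.I * (Real.sqrt d : ℂ))) =>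
        UnitaryTheta.apply_mem_eigenspace_of_commute hYΦ hx) = 0 →
      Yop ∈ (BettiUniverse.hodge exists_isReal_hodgeModel_holds (AbelianVariety.isSmoothProjective_holds (A := Y.prod Z)) 1).hodgeLieC := by
  classical
  intro Yop hYe hYΦ hYZ hYskew hYtr
  have hHD : exists_isReal_hodgeModel := exists_isReal_hodgeModel_holds
  have hI : hodgePQ_independent_of_hodgeModel := hodgePQ_independent_of_hodgeModel_holds
  have hP : IsSmoothProjective (Y.prod Z).dim (Y.prod Z).X := AbelianVariety.isSmoothProjective_holds
  have hXY : IsSmoothProjective Y.dim Y.X := AbelianVariety.isSmoothProjective_holds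
  have hXE : IsSmoothProjective Z.dim Z.X := AbelianVariety.isSmoothProjective_holds
  haveI : Module.Finite ℚ (bettiCohomology (Y.prod Z).X 1) := finite_bettiCohomology_one _
  haveI : Module.Finite ℚ (bettiCohomology Y.X 1) := finite_bettiCohomology_one _
  haveI : Module.Finite ℚ (bettiCohomology Z.X 1) := finite_bettiCohomology_one _
  -- the bicone of `H¹(Y × E)`
  let ι₁ := BettiUniverse.pullHodgeHom hHD hI hP hXY (fst Y Z).hom.hom.hom 1
  let π₁ := BettiUniverse.pullHodgeHom hHD hI hXY hP (prodLift (𝟙 Y) (0 : Y ⟶ Z)).hom.hom.hom 1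
  let ι₂ := BettiUniverse.pullHodgeHom hHD hI hP hXE (snd Y Z).hom.hom.hom 1
  let π₂ := BettiUniverse.pullHodgeHom hHD hI hXE hP (prodLift (0 : Z ⟶ Y) (𝟙 Z)).hom.hom.hom 1
  have hsumP : fst Y Z ≫ prodLift (𝟙 Y) (0 : Y ⟶ Z) + snd Y Z ≫ prodLift (0 : Z ⟶ Y) (𝟙 Z) = 𝟙 _ := by
    refine prod_hom_ext ?_ ?_
    · rw [Preadditive.add_comp, Category.assoc, Category.assoc, prodLift_fst, prodLift_fst, Category.comp_id,
        comp_zero, add_zero, Category.id_comp]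
    · rw [Preadditive.add_comp, Category.assoc, Category.assoc, prodLift_snd, prodLift_snd, Category.comp_id,
        comp_zero, zero_add, Category.id_comp]
  have hπι₁ : ∀ v, π₁.toLinearMap (ι₁.toLinearMap v) = v := fun v => pull_pull_eq_self_of_comp_eq_id (prodLift_fst _ _) v
  have hπι₂ : ∀ v, π₂.toLinearMap (ι₂.toLinearMap v) = v := fun v => pull_pull_eq_self_of_comp_eq_id (prodLift_snd _ _) v
  have hsum : ∀ v, ι₁.toLinearMap (π₁.toLinearMap v) + ι₂.toLinearMap (π₂.toLinearMap v) = v := fun v =>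
    pull_pull_add_pull_pull_eq_self _ _ _ _ hsumP v
  -- effectivity, the Hodge operator of `H¹(Y)`
  have heff := BettiUniverse.hodge_isEffective hHD hP 1
  have heff₁ := BettiUniverse.hodge_isEffective hHD hXY 1
  have heff₂ := BettiUniverse.hodge_isEffective hHD hXE 1
  obtain ⟨Θ₁, hΘ₁⟩ := exists_hodgeTheta (BettiUniverse.hodge hHD hXY 1)
  -- the endomorphisms `φ_Y^*`, `χ^*`, `Φ^*`
  set φ₁ : Module.End ℚ (bettiCohomology Y.X 1) := (bettiCohomology.map φY.hom.hom.hom 1).hom with hφ₁def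
  set φ₂ : Module.End ℚ (bettiCohomology Z.X 1) := (bettiCohomology.map φZ.hom.hom.hom 1).hom with hφ₂def
  set ΦQ : Module.End ℚ (bettiCohomology (Y.prod Z).X 1) := (bettiCohomology.map Φ.hom.hom.hom 1).hom with hΦQdef
  have hφ₁E : φ₁ ∈ (BettiUniverse.hodge hHD hXY 1).endAlg := by
    have h := unop_bettiRep_mem_endAlg hHD hI (AbelianVariety.endAlgebra.of Y φY)
    rwa [bettiRep_of, MulOpposite.unop_op] at h
  have hφ₂E : φ₂ ∈ (BettiUniverse.hodge hHD hXE 1).endAlg := by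
    have h := unop_bettiRep_mem_endAlg hHD hI (AbelianVariety.endAlgebra.of Z φZ)
    rwa [bettiRep_of, MulOpposite.unop_op] at h
  have hΦE : ΦQ ∈ (BettiUniverse.hodge hHD hP 1).endAlg := by
    have h := unop_bettiRep_mem_endAlg hHD hI (AbelianVariety.endAlgebra.of (Y.prod Z) Φ)
    rwa [bettiRep_of, MulOpposite.unop_op] at h
  have hdQ : (0 : ℚ) < d := Nat.cast_pos.2 hd
  have hφ₁sq : φ₁ * φ₁ = -((d : ℚ) • 1) := bettiMapHom_mul_self hφY
  have hφ₂sq : φ₂ * φ₂ = -((d : ℚ) • 1) := bettiMapHom_mul_self hφZ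
  have hμ : (Complex.I * (Real.sqrt d : ℂ)) ^ 2 = -((d : ℚ) : ℂ) := by
    rw [mul_pow, Complex.I_sq, ← Complex.ofReal_pow, Real.sq_sqrt (Nat.cast_nonneg d), Complex.ofReal_natCast,
      Rat.cast_natCast, neg_one_mul]
  have hconj : starRingEnd ℂ (Complex.I * (Real.sqrt d : ℂ)) = -(Complex.I * (Real.sqrt d : ℂ)) := by simp
  -- the gluing of the `k`-action
  have hΦ₁' : ΦQ ∘ₗ ι₁.toLinearMap = ι₁.toLinearMap ∘ₗ φ₁ := by
    change BettiUniverse.pull Φ.hom.hom.hom 1 ∘ₗ BettiUniverse.pull (fst Y Z).hom.hom.hom 1 =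
      BettiUniverse.pull (fst Y Z).hom.hom.hom 1 ∘ₗ BettiUniverse.pull φY.hom.hom.hom 1
    rw [← pull_comp_eq', ← pull_comp_eq', hΦ₁]
  have hΦ₂' : ΦQ ∘ₗ ι₂.toLinearMap = ι₂.toLinearMap ∘ₗ φ₂ := by
    change BettiUniverse.pull Φ.hom.hom.hom 1 ∘ₗ BettiUniverse.pull (snd Y Z).hom.hom.hom 1 =
      BettiUniverse.pull (snd Y Z).hom.hom.hom 1 ∘ₗ BettiUniverse.pull φZ.hom.hom.hom 1
    rw [← pull_comp_eq', ← pull_comp_eq', hΦ₂]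
  -- the balance at `± i√d` from the Weil type `(3,3)` of the diagonal `k`
  have h10 : ∀ cc, Module.finrank ℂ ↥(Module.End.eigenspace (ΦQ.baseChange ℂ) cc ⊓ (BettiUniverse.hodge hHD hP 1).piece 1 0) =
      eigenMultiplicity (Y.prod Z) Φ cc := fun cc => by
    rw [hΦQdef, finrank_eigenspace_inf_piece_oneZero_eq_eigenMultiplicity hHD hI Φ]
  have h01 : ∀ cc, Module.finrank ℂ ↥(Module.End.eigenspace (ΦQ.baseChange ℂ) cc ⊓ (BettiUniverse.hodge hHD hP 1).piece 0 1) =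
      eigenMultiplicity (Y.prod Z) Φ (starRingEnd ℂ cc) := fun cc => by
    rw [hΦQdef, finrank_eigenspace_inf_piece_zeroOne_eq_eigenMultiplicity_conj hHD hI Φ]
  have hbal : Module.finrank ℂ ↥(Module.End.eigenspace (ΦQ.baseChange ℂ) (Complex.I * (Real.sqrt d : ℂ)) ⊓
      (BettiUniverse.hodge hHD hP 1).piece 1 0) =
      Module.finrank ℂ ↥(Module.End.eigenspace (ΦQ.baseChange ℂ) (Complex.I * (Real.sqrt d : ℂ)) ⊓
      (BettiUniverse.hodge hHD hP 1).piece 0 1) := by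
    rw [h10, h01, hconj, hW.eigenMultiplicity_eq, hW.eigenMultiplicity_neg_eq]
  have hbal' : Module.finrank ℂ ↥(Module.End.eigenspace (ΦQ.baseChange ℂ) (-(Complex.I * (Real.sqrt d : ℂ))) ⊓
      (BettiUniverse.hodge hHD hP 1).piece 1 0) =
      Module.finrank ℂ ↥(Module.End.eigenspace (ΦQ.baseChange ℂ) (-(Complex.I * (Real.sqrt d : ℂ))) ⊓
      (BettiUniverse.hodge hHD hP 1).piece 0 1) := by
    rw [h10, h01, map_neg, hconj, neg_neg, hW.eigenMultiplicity_eq, hW.eigenMultiplicity_neg_eq]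
  -- `hLie₁` for `Y₃`: the `(m,1)` core through F17's dictionary
  have hsumY := eigenMultiplicity_add_eigenMultiplicity_neg_eq_dim Y φY hd hφY
  have hY0 : 0 < Y.dim := by omega
  have hEY := exists_eq_smul_one_add_smul_bettiMapHom hHD hI hd hφY hE2 hY0
  obtain ⟨μ, hμ', hm1, hm2⟩ : ∃ μ : ℂ, μ ^ 2 = -((d : ℚ) : ℂ) ∧
      eigenMultiplicity Y φY (starRingEnd ℂ μ) = 1 ∧ 2 ≤ eigenMultiplicity Y φY μ := by
    rcases h1 with h | h
    · exact ⟨-(Complex.I * (Real.sqrt d : ℂ)), by rw [neg_sq, hμ], by rw [map_neg, hconj, neg_neg, h], by omega⟩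
    · exact ⟨Complex.I * (Real.sqrt d : ℂ), hμ, by rw [hconj, h], by omega⟩
  have h1Y : Module.finrank ℂ ↥(Module.End.eigenspace (φ₁.baseChange ℂ) μ ⊓ (BettiUniverse.hodge hHD hXY 1).piece 0 1) = 1 := by
    rw [hφ₁def, finrank_eigenspace_inf_piece_zeroOne_eq_eigenMultiplicity_conj hHD hI φY μ, hm1]
  have h2Y : 2 ≤ Module.finrank ℂ ↥(Module.End.eigenspace (φ₁.baseChange ℂ) μ ⊓ (BettiUniverse.hodge hHD hXY 1).piece 1 0) := by
    rw [hφ₁def, finrank_eigenspace_inf_piece_oneZero_eq_eigenMultiplicity hHD hI φY μ]; exact hm2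
  have hLie₁ : ∀ (ψ₁ : (BettiUniverse.hodge hHD hXY 1).Polarization) (𝔤₁ : Submodule ℚ (Module.End ℚ (bettiCohomology Y.X 1))),
      (∀ X ∈ 𝔤₁, ∀ X' ∈ 𝔤₁, X * X' - X' * X ∈ 𝔤₁) → Θ₁ ∈ spanC 𝔤₁ →
      (∀ X ∈ 𝔤₁, ∀ a : (BettiUniverse.hodge hHD hXY 1).endAlg,
        X * (a : Module.End ℚ (bettiCohomology Y.X 1)) = (a : Module.End ℚ (bettiCohomology Y.X 1)) * X) →
      (∀ X ∈ 𝔤₁, ∀ v w, ψ₁.form (X v) w + ψ₁.form v (X w) = 0) →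
      ∀ T : Module.End ℂ (ℂ ⊗[ℚ] bettiCohomology Y.X 1), T * φ₁.baseChange ℂ = φ₁.baseChange ℂ * T →
        (∀ x y, ψ₁.form.baseChange ℂ (T x) y + ψ₁.form.baseChange ℂ x (T y) = 0) → T ∈ spanC 𝔤₁ :=
    fun ψ₁ 𝔤₁ hbr hΘ𝔤 hcomm hskew T hTφ hTskew =>
      UnitaryTheta.mem_spanC_of_commute_of_skew (BettiUniverse.hodge hHD hXY 1) Nat.cast_one heff₁ ψ₁ hφ₁E hdQ
        hφ₁sq hEY hμ' h1Y h2Y 𝔤₁ hbr hΘ₁ hΘ𝔤 hcomm hskew hTφ hTskew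
  -- `hSL₁` for `Y₃`: K1b
  have hSL₁ : ∀ (ψ₁ : (BettiUniverse.hodge hHD hXY 1).Polarization) (T : Module.End ℂ (ℂ ⊗[ℚ] bettiCohomology Y.X 1)),
      T * φ₁.baseChange ℂ = φ₁.baseChange ℂ * T →
      (∀ x y, ψ₁.form.baseChange ℂ (T x) y + ψ₁.form.baseChange ℂ x (T y) = 0) →
      LinearMap.trace ℂ _ (φ₁.baseChange ℂ * T) = 0 →
      T ∈ Submodule.span ℂ {D : Module.End ℂ (ℂ ⊗[ℚ] bettiCohomology Y.X 1) |
        ∃ A B : Module.End ℂ (ℂ ⊗[ℚ] bettiCohomology Y.X 1),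
        A * φ₁.baseChange ℂ = φ₁.baseChange ℂ * A ∧ B * φ₁.baseChange ℂ = φ₁.baseChange ℂ * B ∧
        (∀ x y, ψ₁.form.baseChange ℂ (A x) y + ψ₁.form.baseChange ℂ x (A y) = 0) ∧
        (∀ x y, ψ₁.form.baseChange ℂ (B x) y + ψ₁.form.baseChange ℂ x (B y) = 0) ∧ D = A * B - B * A} :=
    fun ψ₁ T hTφ hTskew hTtr =>
      UnitarySU.mem_span_commutator_of_trace (BettiUniverse.hodge hHD hXY 1) Nat.cast_one ψ₁ hφ₁E hdQ hφ₁sq hEY hTφ hTskew hTtr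
  -- `hab₂` for the CM threefold
  have hab₂ := CMTorusTheta.hodgeLie_comm_of_isCMTypeRealisation h hHD hI
  -- the projector hypothesis in the bicone's form
  have he₁ : (ι₁.toLinearMap ∘ₗ π₁.toLinearMap) =
      (bettiCohomology.map (fst Y Z ≫ prodLift (𝟙 Y) (0 : Y ⟶ Z)).hom.hom.hom 1).hom := by
    change BettiUniverse.pull (fst Y Z).hom.hom.hom 1 ∘ₗ BettiUniverse.pull (prodLift (𝟙 Y) (0 : Y ⟶ Z)).hom.hom.hom 1 = _
    rw [← pull_comp_eq']
  have hYe' : Yop * (ι₁.toLinearMap ∘ₗ π₁.toLinearMap).baseChange ℂ = (ι₁.toLinearMap ∘ₗ π₁.toLinearMap).baseChange ℂ * Yop := by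
    rw [he₁]; exact hYe
  -- `hY₂` for the CM threefold: the `V₂`-corner of `Yop` commutes with `End(Z)` and is skew for the restricted polarization
  set i₂ := ι₂.toLinearMap.baseChange ℂ with hi₂
  set p₂ := π₂.toLinearMap.baseChange ℂ with hp₂
  have hπι₂' : π₂.toLinearMap ∘ₗ ι₂.toLinearMap = LinearMap.id := LinearMap.ext hπι₂
  have hpi₂ : ∀ x, p₂ (i₂ x) = x := proj_incl_baseChange hπι₂'
  have hG : ∀ g : Z ⟶ Z, ((bettiCohomology.map (snd Y Z ≫ g ≫ prodLift (0 : Z ⟶ Y) (𝟙 Z)).hom.hom.hom 1).hom).baseChange ℂ =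
      i₂ ∘ₗ ((bettiCohomology.map g.hom.hom.hom 1).hom).baseChange ℂ ∘ₗ p₂ := by
    intro g
    change (BettiUniverse.pull (snd Y Z ≫ g ≫ prodLift (0 : Z ⟶ Y) (𝟙 Z)).hom.hom.hom 1).baseChange ℂ =
      (BettiUniverse.pull (snd Y Z).hom.hom.hom 1).baseChange ℂ ∘ₗ (BettiUniverse.pull g.hom.hom.hom 1).baseChange ℂ ∘ₗ
        (BettiUniverse.pull (prodLift (0 : Z ⟶ Y) (𝟙 Z)).hom.hom.hom 1).baseChange ℂ
    rw [pull_comp_eq', pull_comp_eq', LinearMap.baseChange_comp, LinearMap.baseChange_comp]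
  have hzc : ∀ g : Z ⟶ Z, (p₂ ∘ₗ Yop ∘ₗ i₂) * ((bettiCohomology.map g.hom.hom.hom 1).hom).baseChange ℂ =
      ((bettiCohomology.map g.hom.hom.hom 1).hom).baseChange ℂ * (p₂ ∘ₗ Yop ∘ₗ i₂) := by
    intro g
    have hc := hYZ g
    rw [hG g] at hc
    refine LinearMap.ext fun x => ?_
    have hx := LinearMap.congr_fun hc (i₂ x)
    simp only [Module.End.mul_apply, LinearMap.comp_apply, hpi₂] at hx ⊢
    have h2 := congrArg p₂ hx
    rw [hpi₂] at h2
    exact h2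
  -- skewness of the corner for the restricted polarization (needs the block structure of `Yop`)
  obtain ⟨ψ₂, hψ₂⟩ := WeilProductCM.exists_polarization_comp ι₂ π₂ hπι₂ ψ
  set i₁ := ι₁.toLinearMap.baseChange ℂ with hi₁
  set p₁ := π₁.toLinearMap.baseChange ℂ with hp₁
  have hπι₁' : π₁.toLinearMap ∘ₗ ι₁.toLinearMap = LinearMap.id := LinearMap.ext hπι₁
  have h12 : π₁.toLinearMap ∘ₗ ι₂.toLinearMap = 0 := LinearMap.ext fun v => by
    have h' := congrArg π₁.toLinearMap (hsum (ι₂.toLinearMap v))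
    rw [map_add, hπι₂ v, hπι₁] at h'
    exact add_eq_left.1 h'
  have hsum' : ι₁.toLinearMap ∘ₗ π₁.toLinearMap + ι₂.toLinearMap ∘ₗ π₂.toLinearMap = LinearMap.id := LinearMap.ext hsum
  have hp₁i₂ : ∀ x, p₁ (i₂ x) = 0 := proj_incl_baseChange_eq_zero h12
  have hsumC : ∀ y, i₁ (p₁ y) + i₂ (p₂ y) = y := incl_proj_add_baseChange hsum'
  have he₁x : ∀ x, (ι₁.toLinearMap ∘ₗ π₁.toLinearMap).baseChange ℂ x = i₁ (p₁ x) := fun x => by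
    rw [LinearMap.baseChange_comp, LinearMap.comp_apply]
  have hYi₂ : ∀ x, i₂ (p₂ (Yop (i₂ x))) = Yop (i₂ x) := by
    intro x
    have hYe'' : ∀ y, Yop (i₁ (p₁ y)) = i₁ (p₁ (Yop y)) := fun y => by
      rw [← he₁x, ← he₁x, ← Module.End.mul_apply, hYe', Module.End.mul_apply]
    have h1' : i₁ (p₁ (Yop (i₂ x))) = 0 := by rw [← hYe'', hp₁i₂, map_zero, map_zero]
    have h2 := hsumC (Yop (i₂ x))
    rwa [h1', zero_add] at h2
  have hzs : ∀ x y, ψ₂.form.baseChange ℂ ((p₂ ∘ₗ Yop ∘ₗ i₂) x) y + ψ₂.form.baseChange ℂ x ((p₂ ∘ₗ Yop ∘ₗ i₂) y) = 0 := by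
    intro x y
    rw [hψ₂, baseChange_compl₁₂, baseChange_compl₁₂]
    change ψ.form.baseChange ℂ (i₂ (p₂ (Yop (i₂ x)))) (i₂ y) + ψ.form.baseChange ℂ (i₂ x) (i₂ (p₂ (Yop (i₂ y)))) = 0
    rw [hYi₂, hYi₂]
    exact hYskew _ _
  have hY₂ : p₂ ∘ₗ Yop ∘ₗ i₂ ∈ (BettiUniverse.hodge hHD hXE 1).hodgeLieC :=
    CMTorusTheta.mem_hodgeLieC_of_forall_commute_pull_of_skew h hZs (hZ3 ▸ Nat.prime_three) hHD hI ψ₂ hzc hzs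
  -- the brick
  exact WeilProductCM.mem_hodgeLieC_of_commute_of_skew_of_trace_of_abelian ι₁ π₁ ι₂ π₂ hπι₁ hπι₂ hsum Nat.cast_one heff ψ hφ₁E
    hdQ hφ₁sq hφ₂sq hμ hΦE hΦ₁' hΦ₂' hbal hbal' hΘ₁ hLie₁ hSL₁ hab₂ hYe' hYΦ hYskew hYtr hY₂

end Literature.AlgebraicGeometry.HodgeTheory

end
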